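import Mathlib.LinearAlgebra.CrossProduct
import Mathlib.Algebra.BigOperators.Fin
import Mathlib.Algebra.BigOperators.Field
import Mathlib.Data.Real.Basic
import Mathlib.Tactic.LinearCombination
import Mathlib.Tactic.Linarith
import Mathlib.Tactic.Push
import Mathlib.Tactic.FinCases
import Mathlib.Tactic.NormNum
import HarnessLib

/-!
# The direction set `Λ` of the intermittent Beltrami flows (Buckmaster–Vicol; Luo–Titi §3.2)

Analysis/FluidPDE support file, first building block of the intermittent convex-integration
scheme of Buckmaster–Vicol (Ann. of Math. 189 (2019), §3.1) in the explicit form printed by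
T. Luo and E. S. Titi, Calc. Var. PDE 59 (2020) = arXiv:1808.07595, §3.2:

  `Λ⁺ = {(3e₁ ± 4e₂)/5, (3e₂ ± 4e₃)/5, (3e₃ ± 4e₁)/5}`,  `Λ⁻ = -Λ⁺`,  `Λ = Λ⁺ ∪ Λ⁻`
  (six and twelve rational unit vectors), with "`5Λ ⊂ ℤ³`, and
  `min_{ξ,ξ' ∈ Λ, ξ+ξ' ≠ 0} |ξ + ξ'| ≥ 1/5`", and "`(1/8) ∑_{ξ ∈ Λ} (Id - ξ ⊗ ξ) = Id`",

together with the companion vectors of Buckmaster–Vicol's Prop. 3.1 ("`A_ξ ∈ 𝕊² ∩ ℚ³` such that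
`A_ξ · ξ = 0`, `|A_ξ| = 1`, `A_{-ξ} = A_ξ`"), here the explicit choice `A_ξ = e_{i+2}` for
`ξ = (3e_i ± 4e_{i+1})/5`, and `ξ × A_ξ = (±4e_i - 3e_{i+1})/5`, so that `{ξ, A_ξ, ξ × A_ξ}` is a
rational orthonormal frame (BV19 §3.2: "the vectors `{ξ, A_ξ, ξ × A_ξ}` form an orthonormal basis
of `ℝ³`", all in `(1/5)ℤ³`, i.e. `N_Λ = 5` in BV19 Remark 3.3).

## Contents (all proved; finite computations)

* `PIndex = Fin 3 × Bool` indexes `Λ⁺` (`(i, b) ↦ (3e_i + s_b 4e_{i+1})/5`, `s_true = 1`,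
  `s_false = -1`), `LIndex = PIndex × Bool` indexes `Λ` (second flag = "negated");
  `intDirPlus`, `intDir` are the INTEGER vectors `5ξ ∈ ℤ³`, `dirPlus`, `dir` the unit vectors
  `ξ ∈ ℝ³`, `adir` = `A_ξ` (as integers `intAdir`), `cdir` = `ξ × A_ξ` (integers `intCdir = 5 ξ × A_ξ`).
* `dir_neg` (`Λ⁻ = -Λ⁺`), `dir_injective` (the twelve vectors are distinct), unit length and
  orthogonality of the frame (`sum_dir_sq`, `sum_adir_sq`, `sum_cdir_sq`, `sum_dir_mul_adir`, …),
  `crossProduct_dir_adir` (`ξ ×₃ A_ξ = cdir`), the completeness identity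
  `adir ⊗ adir + cdir ⊗ cdir = Id - ξ ⊗ ξ` (`adir_mul_adir_add_cdir_mul_cdir`; this is
  `B_ξ ⊗ B_{-ξ} + B_{-ξ} ⊗ B_ξ = Id - ξ ⊗ ξ` of BV19 Prop. 3.1 in real form),
  `sum_dir_mul_dir` (`∑_Λ ξ_a ξ_b = 4 δ_ab`) and `sum_id_sub_dir_mul_dir`
  (`(1/8) ∑_Λ (δ_ab - ξ_a ξ_b) = δ_ab`), `norm_sq_add_ge` (`|ξ + ξ'|² ≥ 1/25` unless `ξ + ξ' = 0`).

The geometric lemma in Beltrami form (Luo–Titi Prop. 2 = BV19 Prop. 3.2) is the sibling file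
`BeltramiGeometricLemma`; the Beltrami waves `B_ξ e^{iλξ·x}` (BV19 Prop. 3.1) and the
intermittent waves are not here.

## References

* T. Luo, E. S. Titi, Calc. Var. PDE 59 (2020) = arXiv:1808.07595, §3.2 (the sets `Λ^±`,
  (3.2), the identity `(1/8)∑(Id - ξ⊗ξ) = Id`). [`LuoTiti2020`]
* T. Buckmaster, V. Vicol, Ann. of Math. 189 (2019) = arXiv:1709.10033, §3.1 Prop. 3.1,
  Remark 3.3; §3.2. [`BuckmasterVicol2019AnnMath`]
-/

namespace Literature.Analysis.FluidPDE.IntermittentBeltrami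

open Finset

/-! ## Index types and the integer vectors `5ξ`, `A_ξ`, `5 ξ × A_ξ` -/

/-- Index type of `Λ⁺`: `(i, b)` stands for `ξ = (3e_i + s_b · 4e_{i+1})/5` with `s_true = 1`,
`s_false = -1` (indices mod `3`). [cite: LuoTiti2020, §3.2] -/
abbrev PIndex : Type := Fin 3 × Bool

/-- Index type of `Λ = Λ⁺ ∪ Λ⁻`: `(x, n)` stands for `ξ_x` if `n = false` and `-ξ_x` if
`n = true`. [cite: LuoTiti2020, §3.2] -/
abbrev LIndex : Type := PIndex × Bool

/-- The sign `s_b ∈ {4, -4}`-carrying entry: `4` for `true`, `-4` for `false`. [folklore] -/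
def four (b : Bool) : ℤ := if b then 4 else -4

/-- The integer vector `5ξ` for `ξ ∈ Λ⁺`: `3e_i + s_b 4 e_{i+1}`, i.e. `(3, ±4, 0)`,
`(0, 3, ±4)`, `(±4, 0, 3)`. [cite: LuoTiti2020, §3.2] -/
def intDirPlus (x : PIndex) : Fin 3 → ℤ :=
  (![![3, four x.2, 0], ![0, 3, four x.2], ![four x.2, 0, 3]] : Fin 3 → Fin 3 → ℤ) x.1

/-- The integer vector `5ξ` for `ξ ∈ Λ` (negated on `Λ⁻`). [cite: LuoTiti2020, §3.2] -/
def intDir (y : LIndex) : Fin 3 → ℤ := if y.2 then -intDirPlus y.1 else intDirPlus y.1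

/-- The companion unit vector `A_ξ = e_{i+2}` of `ξ = (3e_i ± 4e_{i+1})/5` (an admissible choice
in BV19 Prop. 3.1: rational, unit, orthogonal to `ξ`, even in `ξ`), as an integer vector.
[cite: BuckmasterVicol2019AnnMath, Prop. 3.1] -/
def intAdirPlus (x : PIndex) : Fin 3 → ℤ :=
  (![![0, 0, 1], ![1, 0, 0], ![0, 1, 0]] : Fin 3 → Fin 3 → ℤ) x.1

/-- The integer vector `5 (ξ × A_ξ) = s_b 4 e_i - 3 e_{i+1}`. [cite: BuckmasterVicol2019AnnMath, §3.2] -/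
def intCdirPlus (x : PIndex) : Fin 3 → ℤ :=
  (![![four x.2, -3, 0], ![0, four x.2, -3], ![-3, 0, four x.2]] : Fin 3 → Fin 3 → ℤ) x.1

/-- The unit vector `ξ ∈ Λ⁺ ⊂ 𝕊² ∩ ℚ³`. [cite: LuoTiti2020, §3.2] -/
noncomputable def dirPlus (x : PIndex) : Fin 3 → ℝ := fun q => (intDirPlus x q : ℝ) / 5

/-- The unit vector `ξ ∈ Λ ⊂ 𝕊² ∩ ℚ³`. [cite: LuoTiti2020, §3.2] -/
noncomputable def dir (y : LIndex) : Fin 3 → ℝ := fun q => (intDir y q : ℝ) / 5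

/-- `A_ξ` for `ξ ∈ Λ` (even: `A_{-ξ} = A_ξ`). [cite: BuckmasterVicol2019AnnMath, Prop. 3.1] -/
noncomputable def adir (y : LIndex) : Fin 3 → ℝ := fun q => (intAdirPlus y.1 q : ℝ)

/-- `ξ × A_ξ` for `ξ ∈ Λ` (odd in `ξ`). [cite: BuckmasterVicol2019AnnMath, §3.2] -/
noncomputable def cdir (y : LIndex) : Fin 3 → ℝ :=
  fun q => (if y.2 then -1 else 1) * (intCdirPlus y.1 q : ℝ) / 5

/-! ## Integer identities (decided by computation) -/

/-- `|5ξ|² = 25` on `Λ⁺`. [folklore] -/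
theorem sum_intDirPlus_sq (x : PIndex) : ∑ q, intDirPlus x q * intDirPlus x q = 25 := by
  obtain ⟨i, b⟩ := x
  fin_cases i <;> cases b <;> simp [intDirPlus, four, Fin.sum_univ_three]

/-- `|A_ξ|² = 1`. [folklore] -/
theorem sum_intAdirPlus_sq (x : PIndex) : ∑ q, intAdirPlus x q * intAdirPlus x q = 1 := by
  obtain ⟨i, b⟩ := x
  fin_cases i <;> simp [intAdirPlus, Fin.sum_univ_three]

/-- `|5 ξ × A_ξ|² = 25`. [folklore] -/
theorem sum_intCdirPlus_sq (x : PIndex) : ∑ q, intCdirPlus x q * intCdirPlus x q = 25 := by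
  obtain ⟨i, b⟩ := x
  fin_cases i <;> cases b <;> simp [intCdirPlus, four, Fin.sum_univ_three]

/-- `ξ · A_ξ = 0`. [cite: BuckmasterVicol2019AnnMath, Prop. 3.1] -/
theorem sum_intDirPlus_mul_intAdirPlus (x : PIndex) : ∑ q, intDirPlus x q * intAdirPlus x q = 0 := by
  obtain ⟨i, b⟩ := x
  fin_cases i <;> cases b <;> simp [intDirPlus, intAdirPlus, four, Fin.sum_univ_three]

/-- `ξ · (ξ × A_ξ) = 0`. [folklore] -/
theorem sum_intDirPlus_mul_intCdirPlus (x : PIndex) : ∑ q, intDirPlus x q * intCdirPlus x q = 0 := by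
  obtain ⟨i, b⟩ := x
  fin_cases i <;> cases b <;> simp [intDirPlus, intCdirPlus, four, Fin.sum_univ_three]

/-- `A_ξ · (ξ × A_ξ) = 0`. [folklore] -/
theorem sum_intAdirPlus_mul_intCdirPlus (x : PIndex) : ∑ q, intAdirPlus x q * intCdirPlus x q = 0 := by
  obtain ⟨i, b⟩ := x
  fin_cases i <;> cases b <;> simp [intAdirPlus, intCdirPlus, four, Fin.sum_univ_three]

/-- `(5ξ) ×₃ A_ξ = 5 (ξ × A_ξ)` (Mathlib's `crossProduct`). [folklore] -/
theorem crossProduct_intDirPlus_intAdirPlus (x : PIndex) :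
    crossProduct (intDirPlus x) (intAdirPlus x) = intCdirPlus x := by
  obtain ⟨i, b⟩ := x
  fin_cases i <;> cases b <;>
    simp [intDirPlus, intAdirPlus, intCdirPlus, four, cross_apply]

/-- Completeness of the frame, integer form: `25 A_a A_b + (5ξ×A)_a (5ξ×A)_b = 25 δ_ab - (5ξ)_a (5ξ)_b`
(i.e. `A⊗A + (ξ×A)⊗(ξ×A) = Id - ξ⊗ξ`). [cite: BuckmasterVicol2019AnnMath, Prop. 3.1] -/
theorem frame_complete_int (x : PIndex) (a b : Fin 3) :
    25 * (intAdirPlus x a * intAdirPlus x b) + intCdirPlus x a * intCdirPlus x b =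
      (if a = b then 25 else 0) - intDirPlus x a * intDirPlus x b := by
  obtain ⟨i, c⟩ := x
  fin_cases i <;> cases c <;> fin_cases a <;> fin_cases b <;>
    simp [intDirPlus, intAdirPlus, intCdirPlus, four]

/-- `∑_{ξ ∈ Λ} (5ξ)_a (5ξ)_b = 100 δ_ab` (i.e. `∑_Λ ξ ⊗ ξ = 4 Id`). [cite: LuoTiti2020, §3.2] -/
theorem sum_intDir_mul_intDir (a b : Fin 3) :
    ∑ y : LIndex, intDir y a * intDir y b = if a = b then 100 else 0 := by
  fin_cases a <;> fin_cases b <;>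
    simp [Fintype.sum_prod_type, Fin.sum_univ_three, intDir, intDirPlus, four]

/-! ## The real vectors: `Λ`, `A_ξ`, `ξ × A_ξ` -/

/-- `Λ⁻ = -Λ⁺`: flipping the sign flag negates the vector. [cite: LuoTiti2020, §3.2] -/
theorem dir_neg (x : PIndex) (n : Bool) : dir (x, !n) = -dir (x, n) := by
  funext q
  cases n <;> simp [dir, intDir, neg_div]

/-- On `Λ⁺` (flag `false`) `dir` is `dirPlus`. [folklore] -/
theorem dir_false (x : PIndex) : dir (x, false) = dirPlus x := by
  funext q; simp [dir, dirPlus, intDir]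

/-- On `Λ⁻` (flag `true`) `dir` is `-dirPlus`. [folklore] -/
theorem dir_true (x : PIndex) : dir (x, true) = -dirPlus x := by
  funext q; simp [dir, dirPlus, intDir, neg_div]

/-- Products of two entries do not see the sign: `ξ_a ξ_b` is the same on `±ξ`. [folklore] -/
theorem dir_mul_dir (y : LIndex) (a b : Fin 3) : dir y a * dir y b = dirPlus y.1 a * dirPlus y.1 b := by
  obtain ⟨x, n⟩ := y
  cases n
  · rw [dir_false]
  · rw [dir_true]; simp

/-- `A_{-ξ} = A_ξ`. [cite: BuckmasterVicol2019AnnMath, Prop. 3.1] -/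
theorem adir_neg (x : PIndex) (n : Bool) : adir (x, !n) = adir (x, n) := rfl

/-- `(-ξ) × A_{-ξ} = -(ξ × A_ξ)`. [folklore] -/
theorem cdir_neg (x : PIndex) (n : Bool) : cdir (x, !n) = -cdir (x, n) := by
  funext q
  cases n <;> simp [cdir, neg_div]

/-- `5ξ ∈ ℤ³`: every entry of `ξ ∈ Λ` is an integer divided by `5`. [cite: LuoTiti2020, §3.2 (3.2)] -/
theorem dir_mem_fifth (y : LIndex) (q : Fin 3) : ∃ m : ℤ, dir y q = m / 5 := ⟨intDir y q, rfl⟩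

/-- `|ξ|² = 1` for `ξ ∈ Λ`. [cite: LuoTiti2020, §3.2] -/
theorem sum_dir_sq (y : LIndex) : ∑ q, dir y q * dir y q = 1 := by
  have h : ∀ q, dir y q * dir y q = ((intDirPlus y.1 q * intDirPlus y.1 q : ℤ) : ℝ) / 25 := by
    intro q
    rw [dir_mul_dir]
    simp [dirPlus]
    ring
  simp_rw [h, ← Finset.sum_div, ← Int.cast_sum, sum_intDirPlus_sq]
  norm_num

/-- `|A_ξ|² = 1`. [cite: BuckmasterVicol2019AnnMath, Prop. 3.1] -/
theorem sum_adir_sq (y : LIndex) : ∑ q, adir y q * adir y q = 1 := by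
  simp only [adir, ← Int.cast_mul, ← Int.cast_sum, sum_intAdirPlus_sq, Int.cast_one]

/-- `|ξ × A_ξ|² = 1`. [folklore] -/
theorem sum_cdir_sq (y : LIndex) : ∑ q, cdir y q * cdir y q = 1 := by
  have h : ∀ q, cdir y q * cdir y q = ((intCdirPlus y.1 q * intCdirPlus y.1 q : ℤ) : ℝ) / 25 := by
    intro q
    obtain ⟨x, n⟩ := y
    cases n <;> simp [cdir] <;> ring
  simp_rw [h, ← Finset.sum_div, ← Int.cast_sum, sum_intCdirPlus_sq]
  norm_num

/-- `ξ · A_ξ = 0`. [cite: BuckmasterVicol2019AnnMath, Prop. 3.1] -/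
theorem sum_dir_mul_adir (y : LIndex) : ∑ q, dir y q * adir y q = 0 := by
  have h : ∀ q, dir y q * adir y q =
      (if y.2 then -1 else 1) * (((intDirPlus y.1 q * intAdirPlus y.1 q : ℤ) : ℝ) / 5) := by
    intro q
    obtain ⟨x, n⟩ := y
    cases n <;> simp [dir, adir, intDir] <;> ring
  simp_rw [h, ← Finset.mul_sum, ← Finset.sum_div, ← Int.cast_sum, sum_intDirPlus_mul_intAdirPlus]
  simp

/-- `ξ · (ξ × A_ξ) = 0`. [folklore] -/
theorem sum_dir_mul_cdir (y : LIndex) : ∑ q, dir y q * cdir y q = 0 := by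
  have h : ∀ q, dir y q * cdir y q = ((intDirPlus y.1 q * intCdirPlus y.1 q : ℤ) : ℝ) / 25 := by
    intro q
    obtain ⟨x, n⟩ := y
    cases n <;> simp [dir, cdir, intDir] <;> ring
  simp_rw [h, ← Finset.sum_div, ← Int.cast_sum, sum_intDirPlus_mul_intCdirPlus]
  simp

/-- `A_ξ · (ξ × A_ξ) = 0`. [folklore] -/
theorem sum_adir_mul_cdir (y : LIndex) : ∑ q, adir y q * cdir y q = 0 := by
  have h : ∀ q, adir y q * cdir y q =
      (if y.2 then -1 else 1) * (((intAdirPlus y.1 q * intCdirPlus y.1 q : ℤ) : ℝ) / 5) := by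
    intro q
    obtain ⟨x, n⟩ := y
    cases n <;> simp [adir, cdir] <;> ring
  simp_rw [h, ← Finset.mul_sum, ← Finset.sum_div, ← Int.cast_sum, sum_intAdirPlus_mul_intCdirPlus]
  simp

/-- **`cdir` is the cross product**: `ξ ×₃ A_ξ = cdir` for every `ξ ∈ Λ`. [cite: BuckmasterVicol2019AnnMath, §3.2] -/
theorem crossProduct_dir_adir (y : LIndex) : crossProduct (dir y) (adir y) = cdir y := by
  obtain ⟨⟨i, b⟩, n⟩ := y
  funext q
  fin_cases i <;> cases b <;> cases n <;> fin_cases q <;>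
    simp [cross_apply, dir, adir, cdir, intDir, intDirPlus, intAdirPlus, intCdirPlus, four] <;> norm_num

/-- **Completeness of the orthonormal frame `{ξ, A_ξ, ξ × A_ξ}`**:
`(A_ξ)_a (A_ξ)_b + (ξ×A_ξ)_a (ξ×A_ξ)_b = δ_ab - ξ_a ξ_b`, the real form of
`B_ξ ⊗ B_{-ξ} + B_{-ξ} ⊗ B_ξ = Id - ξ ⊗ ξ`. [cite: BuckmasterVicol2019AnnMath, Prop. 3.1] -/
theorem adir_mul_adir_add_cdir_mul_cdir (y : LIndex) (a b : Fin 3) :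
    adir y a * adir y b + cdir y a * cdir y b = (if a = b then 1 else 0) - dir y a * dir y b := by
  have h := frame_complete_int y.1 a b
  have h' : (25 : ℝ) * (intAdirPlus y.1 a * intAdirPlus y.1 b) + intCdirPlus y.1 a * intCdirPlus y.1 b =
      (if a = b then 25 else 0) - intDirPlus y.1 a * intDirPlus y.1 b := by
    have := congrArg (fun z : ℤ => (z : ℝ)) h
    push_cast at this
    convert this using 2
  have hc : cdir y a * cdir y b = ((intCdirPlus y.1 a : ℝ) * intCdirPlus y.1 b) / 25 := by
    obtain ⟨x, n⟩ := y
    cases n <;> simp [cdir] <;> ring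
  rw [dir_mul_dir, hc]
  simp only [adir, dirPlus]
  split_ifs at h' ⊢ with hab <;> linear_combination h' / 25

/-- **`∑_{ξ ∈ Λ} ξ_a ξ_b = 4 δ_ab`** (`∑_Λ ξ ⊗ ξ = 4 Id`). [cite: LuoTiti2020, §3.2] -/
theorem sum_dir_mul_dir (a b : Fin 3) : ∑ y : LIndex, dir y a * dir y b = if a = b then 4 else 0 := by
  have h : ∀ y : LIndex, dir y a * dir y b = ((intDir y a * intDir y b : ℤ) : ℝ) / 25 := by
    intro y
    simp [dir]
    ring
  simp_rw [h, ← Finset.sum_div, ← Int.cast_sum, sum_intDir_mul_intDir]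
  split_ifs <;> norm_num

/-- **Luo–Titi's identity `(1/8) ∑_{ξ ∈ Λ} (Id - ξ ⊗ ξ) = Id`**, entrywise. [cite: LuoTiti2020, §3.2] -/
theorem sum_id_sub_dir_mul_dir (a b : Fin 3) :
    (1 / 8 : ℝ) * ∑ y : LIndex, ((if a = b then (1 : ℝ) else 0) - dir y a * dir y b) =
      if a = b then 1 else 0 := by
  rw [Finset.sum_sub_distrib, sum_dir_mul_dir]
  simp only [Finset.sum_const, Finset.card_univ, nsmul_eq_mul]
  have hcard : (Fintype.card LIndex : ℝ) = 12 := by norm_num [Fintype.card_prod, Fintype.card_bool]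
  rw [hcard]
  split_ifs <;> norm_num

/-- **Separation of `Λ`**: for `ξ, ξ' ∈ Λ` either `ξ + ξ' = 0` or `|ξ + ξ'|² ≥ 1/25` (as
`5(ξ + ξ') ∈ ℤ³ ∖ {0}`), Luo–Titi's "`min_{ξ+ξ'≠0} |ξ + ξ'| ≥ 1/5`" (BV19's constant
`2c_Λ`). [cite: LuoTiti2020, §3.2 (3.2)] -/
theorem norm_sq_add_ge (y y' : LIndex) (h : dir y + dir y' ≠ 0) :
    (1 / 25 : ℝ) ≤ ∑ q, (dir y q + dir y' q) * (dir y q + dir y' q) := by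
  -- some entry of the integer vector `5ξ + 5ξ'` is nonzero, and its square is `≥ 1`
  have hne : ∃ q, intDir y q + intDir y' q ≠ 0 := by
    by_contra hall
    push Not at hall
    apply h
    funext q
    have := hall q
    simp only [Pi.add_apply, dir, Pi.zero_apply]
    rw [← add_div, ← Int.cast_add, this]
    simp
  obtain ⟨q₀, hq₀⟩ := hne
  have hterm : ∀ q, (dir y q + dir y' q) * (dir y q + dir y' q) =
      (((intDir y q + intDir y' q) * (intDir y q + intDir y' q) : ℤ) : ℝ) / 25 := by
    intro q
    simp [dir]
    ring
  simp_rw [hterm, ← Finset.sum_div, ← Int.cast_sum]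
  have h1 : (1 : ℤ) ≤ ∑ q, (intDir y q + intDir y' q) * (intDir y q + intDir y' q) := by
    have hsq : (1 : ℤ) ≤ (intDir y q₀ + intDir y' q₀) * (intDir y q₀ + intDir y' q₀) := by
      have := mul_self_pos.mpr hq₀
      omega
    exact hsq.trans (Finset.single_le_sum (f := fun q => (intDir y q + intDir y' q) * (intDir y q + intDir y' q))
      (fun q _ => mul_self_nonneg _) (Finset.mem_univ q₀))
  have h1' : (1 : ℝ) ≤ ((∑ q, (intDir y q + intDir y' q) * (intDir y q + intDir y' q) : ℤ) : ℝ) := by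
    exact_mod_cast h1
  linarith

/-- **The twelve vectors of `Λ` are pairwise distinct** (`dir` is injective), so `LIndex`
enumerates a genuine twelve-element set `Λ ⊂ 𝕊² ∩ ℚ³`. [cite: LuoTiti2020, §3.2] -/
theorem dir_injective : Function.Injective dir := by
  intro y y' h
  have hint : intDir y = intDir y' := by
    funext q
    have := congr_fun h q
    simp only [dir] at this
    exact_mod_cast (div_left_inj' (by norm_num : (5 : ℝ) ≠ 0)).mp this
  revert hint
  obtain ⟨⟨i, b⟩, n⟩ := y
  obtain ⟨⟨i', b'⟩, n'⟩ := y'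
  fin_cases i <;> cases b <;> cases n <;> fin_cases i' <;> cases b' <;> cases n' <;>
    simp [intDir, intDirPlus, four, funext_iff, Fin.forall_fin_succ]

end Literature.Analysis.FluidPDE.IntermittentBeltrami
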